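import Summits.BirchSwinnertonDyer.BirchSwinnertonDyer.Theorems.ErratumRoadFiveNonSurjCornerMuCore
import Summits.BirchSwinnertonDyer.BirchSwinnertonDyer.Theorems.KatoDescentPotSupersingularMuCoreIrrCoreStepOne
import Summits.BirchSwinnertonDyer.BirchSwinnertonDyer.Theorems.KatoDescentPotSupersingularMuCoreIrrStepTwo
import Summits.BirchSwinnertonDyer.BirchSwinnertonDyer.Theorems.KatoDescentPotSupersingularMuCoreIrrStepsTwoFour
import Summits.BirchSwinnertonDyer.BirchSwinnertonDyer.Theorems.KatoDescentPotSupersingularMuCoreIrrSelmerDual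
import HarnessLib

/-!
# The K6 `μ`-core under IMAGE FACTS instead of `ρ̄` not onto — part G: THE CORE, reduction-free, at every odd
# prime under (SC)+(IF), and at `p = 3` for EVERY `E/ℚ` with `E[3]` irreducible (9-deficient rows included)
# (route `KatoDescentPotSupersingular`, U₀ parent item stmt-BirchSwinnertonDyer-19197 / U₀-ns node 19189;
# route-free helper)

Seat `bsd-potss-k9-c4` g14 (prover; cell `bsd-potss`); `--supports stmt-BirchSwinnertonDyer-19197 --as helper`;
closes nothing.  HONEST FRAMING: BSD is not proved by any of this; nothing is booked; THEOREMS ONLY; the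
mathematics and the proof text of the assembly are the K6 cells' (`bsd-smallim` k6-c2 g3
`coreOdd_of_selmerDual_of_stepsTwoFour`, `bsd-stepL` corner-p1 g6 `coreOdd_anyReduction_…`; MU-TRANSFER-PROOF §5);
this file re-keys the binder `¬ W.HasSurjectiveModNGaloisRep p` into the image facts (SC) (a Galois scalar `≠ 1`
on `E[p]`) and (IF) (no normal index-`p` subgroup of `Γ_ℚ` above `ker ρ̄_{E,p}`) through parts A–F
(`…MuCoreIrr{ImageFacts,StepOne,CoreStepOne,StepTwo,StepsTwoFour,SelmerDual}`), and discharges both at `p = 3`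
from `E[3]` irreducible ALONE.

* `CoreAssembly.coreIrr_anyReduction_of_selmerDual_of_stepsTwoFour` — the assembly (verbatim) over the binder-free
  stubs and (SC)/(IF);
* `CoreAssembly.coreIrr_anyReduction_holds` — UNCONDITIONAL (inputs: Kato §13.8 weak form, Poitou–Tate over `ℚ`,
  local Euler–Poincaré, parts E/F);
* **`CoreAssembly.coreThree_anyReduction_of_irr`** — at `p = 3`, for EVERY globally minimal elliptic `W/ℚ` with
  `E[3]` irreducible, every cyclotomic `(κ, γ)`, pin `I`: a genuine Λ-adic Euler-system class `s ∉ 3𝐇¹` kills the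
  `T`-divisible growth of `Sel₀(ℚ_∞, E[3^∞])[3]` — the engine of rkm g15's fine road, now available on the
  9-deficient U₀-ns rows (`ρ̄₃` onto, `ρ̄₉` not) where the K6 binder `¬Surj` fails.

References: [Kato2004Asterisque] §13.3, §13.8, Thm. 12.4, Lemma 8.5 (2); [MazurRubin2004] Prop. 1.3.2, §4.4, §5.3;
[MilneADT2006] I Thm. 2.8, 4.10; [Serre1972] §2.4 Prop. 15, §2.5–2.6.
-/

set_option linter.dupNamespace false
set_option autoImplicit false

noncomputable section

open scoped Classical NumberField
open WeierstrassCurve Field IsDedekindDomain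
open Literature.NumberTheory.GaloisRepresentations
open Literature.NumberTheory.GaloisCohomology
open Literature.NumberTheory.EllipticCurves
open Literature.NumberTheory.EllipticCurves.Kato2004
open Literature.NumberTheory.EllipticCurves.Kato2004.EulerSystemValues
open Summit.BirchSwinnertonDyer.BirchSwinnertonDyer.Rank1Residual

namespace Summit.BirchSwinnertonDyer.BirchSwinnertonDyer.Rank1Residual.CoreAssembly

/-- (Twin of `coreOdd_anyReduction_of_selmerDual_of_stepsTwoFour` with the image facts (SC)/(IF) in place of `ρ̄_{E,p}` not onto, and the two stubs taken WITHOUT that binder; K6 proof text verbatim.) **The core of the `μ`-transfer at every ODD prime, class-free AND REDUCTION-FREE, from the two (landed) stubs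
of K6's skeleton v6 and three published facts** — verbatim `coreOdd_of_selmerDual_of_stepsTwoFour` (k6-c2 g3) with
the inert binders `W.HasGoodReductionAtPrime p`, `p ∤ a_p` deleted from the conclusion; the proof text is copied
unchanged (MU-TRANSFER-PROOF §5: Step 0 → level `e = p^n` → bad class `y` → `Ψ` → truncation → joint value →
Step 2 Frobenius → Steps 3–4 reciprocity → the count → contradiction). `hred`: Kato §13.8; `hPT`: Poitou–Tate over
`ℚ`; `hEP`: local Euler–Poincaré characteristic; `hG1`/`hG34`: the statements of `SelmerDual.stub_selmerDualOdd_holds` /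
`TameClass.stub_stepsTwoFourOdd_holds`. [cite: Kato2004Asterisque, §13.3, §13.8 (pp. 228–229) and Thm. 12.4 (p. 221)]
[cite: MazurRubin2004, Prop. 1.3.2, §4.4, §5.3] [cite: MilneADT2006, Ch. I, Thm. 2.8 and Thm. 4.10(b)] -/
theorem coreIrr_anyReduction_of_selmerDual_of_stepsTwoFour (hred : mem_pSmul_of_red_eq_zero)
    (hPT : poitouTate_sum_localTatePairing_eq_zero ℚ)
    (hEP : ∀ v : HeightOneSpectrum (𝓞 ℚ), localEulerPoincareCharacteristic (v.adicCompletion ℚ))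
    (hG1 :     ∀ (W : WeierstrassCurve ℚ) [W.IsElliptic] [W.IsGloballyMinimal] (p : ℕ) [Fact p.Prime]
      (κ : ZpExtension ℚ p) (γ : absoluteGaloisGroup ℚ),
      p ≠ 2 → W.HasIrreducibleModPGaloisRep p →
      κ.IsCyclotomic → κ.IsTopGenerator γ →
      (∀ v : HeightOneSpectrum (𝓞 ℚ), localEulerPoincareCharacteristic (v.adicCompletion ℚ)) →
      poitouTate_sum_localTatePairing_eq_zero ℚ →
      ∀ (S₀ : Set (HeightOneSpectrum (𝓞 ℚ))), S₀.Finite →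
      ∃ (ε : ℕ) (S : Set (HeightOneSpectrum (𝓞 ℚ))), S.Finite ∧ S₀ ⊆ S ∧
        ∀ (J : ℕ) (y : Literature.NumberTheory.EllipticCurves.subgroupH1 κ.kerSubgroup
            (WeierstrassCurve.geomTorsion W (p : ℤ))),
          W.torsionToPrimaryH1Sub p κ.kerSubgroup y ∈ W.fineSelmerInfty κ →
          (⇑(Literature.NumberTheory.EllipticCurves.conjH1 κ.kerSubgroup
              (WeierstrassCurve.geomTorsion W (p : ℤ)) γ -
            AddMonoidHom.id (Literature.NumberTheory.EllipticCurves.subgroupH1 κ.kerSubgroup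
              (WeierstrassCurve.geomTorsion W (p : ℤ)))))^[J] y ≠ 0 →
          ∃ Ψ : galoisCohomology (W.modPTwist p κ.invTwist (J + 1)) 1,
            (κ.invTwist.shiftH1 (W.torsionGaloisModule (p : ℤ))
                (fun P : WeierstrassCurve.geomTorsion W (p : ℤ) => AddSubgroup.torsionBy.nsmul P)
                (J + 1))^[J] Ψ ≠ 0 ∧
            (∀ v : HeightOneSpectrum (𝓞 ℚ), v ∉ S →
              galoisCohomology.localization (W.modPTwist p κ.invTwist (J + 1)) (Sum.inr v) 1 Ψ ∈
                DiscreteGaloisModule.unramifiedSubgroup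
                  (GaloisRep.toLocal v (W.modPTwist p κ.invTwist (J + 1))) 1) ∧
            (∀ v : HeightOneSpectrum (𝓞 ℚ), v ∈ S →
              galoisCohomology.localization (W.modPTwist p κ.invTwist (J + 1)) (Sum.inr v) 1
                ((κ.invTwist.shiftH1 (W.torsionGaloisModule (p : ℤ))
                  (fun P : WeierstrassCurve.geomTorsion W (p : ℤ) => AddSubgroup.torsionBy.nsmul P)
                  (J + 1))^[ε] Ψ) = 0))
    (hG34 :     ∀ (W : WeierstrassCurve ℚ) [W.IsElliptic] [W.IsGloballyMinimal] (p : ℕ) [Fact p.Prime]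
      [ContinuousSMul ℤ_[p] (W.tateModule p)] [Module.Free ℤ_[p] (W.tateModule p)]
      [Module.Finite ℤ_[p] (W.tateModule p)]
      (κ : ZpExtension ℚ p) (γ : absoluteGaloisGroup ℚ) (I : IwasawaH1Data W p κ γ),
      p ≠ 2 → W.HasIrreducibleModPGaloisRep p →
      κ.IsCyclotomic → κ.IsTopGenerator γ →
      poitouTate_sum_localTatePairing_eq_zero ℚ →
      ∀ (s : I.H), IsEulerSystemClass W p κ γ I s →
      ∃ (S₀ : Set (HeightOneSpectrum (𝓞 ℚ))), S₀.Finite ∧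
        ∀ (a : ℕ) (κ' : κ.twistTower (W.torsionGaloisModule (p : ℤ))
            (fun P : WeierstrassCurve.geomTorsion W (p : ℤ) => AddSubgroup.torsionBy.nsmul P)),
          (κ.towerShift (W.torsionGaloisModule (p : ℤ))
              (fun P : WeierstrassCurve.geomTorsion W (p : ℤ) => AddSubgroup.torsionBy.nsmul P))^[a]
            κ' = I.redTower s →
          ∀ (n e' : ℕ), e' + 1 = p ^ n →
          ∀ (Φ : contOneCocycles (W.modPTwist p κ (2 * e' + 1 + 1)).toTopRep),
            oneCocycleClass (W.modPTwist p κ (2 * e' + 1 + 1)).toTopRep Φ = κ'.1 (2 * e' + 1 + 1) →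
          ∀ (ε : ℕ) (S₁ : Set (HeightOneSpectrum (𝓞 ℚ)))
            (Ψ : galoisCohomology (W.modPTwist p κ.invTwist (2 * e' + 1 + 1)) 1)
            (Ψc : contOneCocycles (W.modPTwist p κ.invTwist (2 * e' + 1 + 1)).toTopRep),
            S₀ ⊆ S₁ →
            oneCocycleClass (W.modPTwist p κ.invTwist (2 * e' + 1 + 1)).toTopRep Ψc = Ψ →
            (∀ v : HeightOneSpectrum (𝓞 ℚ), v ∉ S₁ →
              galoisCohomology.localization (W.modPTwist p κ.invTwist (2 * e' + 1 + 1)) (Sum.inr v) 1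
                  Ψ ∈
                DiscreteGaloisModule.unramifiedSubgroup
                  (GaloisRep.toLocal v (W.modPTwist p κ.invTwist (2 * e' + 1 + 1))) 1) →
            (∀ v : HeightOneSpectrum (𝓞 ℚ), v ∈ S₁ →
              galoisCohomology.localization (W.modPTwist p κ.invTwist (2 * e' + 1 + 1)) (Sum.inr v) 1
                ((κ.invTwist.shiftH1 (W.torsionGaloisModule (p : ℤ))
                  (fun P : WeierstrassCurve.geomTorsion W (p : ℤ) => AddSubgroup.torsionBy.nsmul P)
                  (2 * e' + 1 + 1))^[ε] Ψ) = 0) →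
          ∀ (eW : WeierstrassCurve.geomTorsion W (p : ℤ) → WeierstrassCurve.geomTorsion W (p : ℤ) →
              AlgebraicClosure ℚ)
            (hμ : ∀ S T, eW S T ^ p = 1)
            (hadd₁ : ∀ S₁' S₂' T, eW (S₁' + S₂') T = eW S₁' T * eW S₂' T)
            (hadd₂ : ∀ S T₁ T₂, eW S (T₁ + T₂) = eW S T₁ * eW S T₂),
            (∀ T, eW T T = 1) → (∀ T, (∀ S, eW S T = 1) → T = 0) →
            (∀ (σ : absoluteGaloisGroup ℚ) (S T : WeierstrassCurve.geomTorsion W (p : ℤ)),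
              σ • eW S T = eW (σ • S) (σ • T)) →
          ∀ (q : HeightOneSpectrum (𝓞 ℚ)), q ∉ S₁ →
          ∀ 𝔓 ∈ q.primesAbove, ∀ (Fr : absoluteGaloisGroup ℚ), IsArithFrobAt (𝓞 ℚ) Fr 𝔓 →
            WeierstrassCurve.galoisRepTorsion W p Fr = 1 →
            Fr ∈ κ.layerSubgroup n → Fr ∉ κ.layerSubgroup (n + 1) →
          ∃ U : Polynomial ℤ, ¬ ((p : ℤ) ∣ U.coeff 0) ∧
            ∀ i : ℕ, i + ε < 2 * e' + 1 + 1 →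
              convCoeff (weilPairingHom W p eW hμ hadd₁ hadd₂) (2 * e' + 1 + 1) i
                (Polynomial.aeval (shiftEnd (WeierstrassCurve.geomTorsion W (p : ℤ)) (2 * e' + 1 + 1)) U
                  ((shiftEnd (WeierstrassCurve.geomTorsion W (p : ℤ)) (2 * e' + 1 + 1) ^ (e' + 1 + a))
                    (Φ.1 Fr)))
                (Ψc.1 Fr) = 0) :
    ∀ (W : WeierstrassCurve ℚ) [W.IsElliptic] [W.IsGloballyMinimal] (p : ℕ) [Fact p.Prime]
      [ContinuousSMul ℤ_[p] (W.tateModule p)] [Module.Free ℤ_[p] (W.tateModule p)]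
      [Module.Finite ℤ_[p] (W.tateModule p)]
      (κ : ZpExtension ℚ p) (γ : absoluteGaloisGroup ℚ) (I : IwasawaH1Data W p κ γ),
      p ≠ 2 → W.HasIrreducibleModPGaloisRep p →
      (∃ (z : absoluteGaloisGroup ℚ) (a : ZMod p), a ≠ 1 ∧
        ∀ P : WeierstrassCurve.geomTorsion W (p : ℤ), z • P = a.val • P) →
      (∀ N : Subgroup (absoluteGaloisGroup ℚ), N.Normal →
        (WeierstrassCurve.galoisRepTorsion W (p : ℕ)).ker ≤ N → N.index ≠ p) →
      κ.IsCyclotomic → κ.IsTopGenerator γ →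
      (∃ s : I.H, IsEulerSystemClass W p κ γ I s ∧
        s ∉ IwasawaAlgebra.augIdealP p • (⊤ : Submodule (IwasawaAlgebra p) I.H)) →
      ∃ J : ℕ, ∀ y : Literature.NumberTheory.EllipticCurves.subgroupH1 κ.kerSubgroup
          (WeierstrassCurve.geomTorsion W (p : ℤ)),
        W.torsionToPrimaryH1Sub p κ.kerSubgroup y ∈ W.fineSelmerInfty κ →
          (⇑(Literature.NumberTheory.EllipticCurves.conjH1 κ.kerSubgroup
              (WeierstrassCurve.geomTorsion W (p : ℤ)) γ -
            AddMonoidHom.id (Literature.NumberTheory.EllipticCurves.subgroupH1 κ.kerSubgroup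
              (WeierstrassCurve.geomTorsion W (p : ℤ)))))^[J] y = 0 := by
  intro W _ _ p _ _ _ _ κ γ I hp2 hirr hSC hIF hκ hγ hs
  obtain ⟨s, hES, hsp⟩ := hs
  have hp : p.Prime := Fact.out
  haveI : Finite (WeierstrassCurve.geomTorsion W (p : ℤ)) :=
    WeierstrassCurve.finite_torsionPoints_holds W (AlgebraicClosure ℚ) (by exact_mod_cast hp.ne_zero)
  -- STEP 0: `red_Ω s = T^a κ'`, `κ' ∉ T𝐇¹_Ω`, `κ̄' ≠ 0`
  have ht : I.redTower s ≠ 0 := I.redTower_ne_zero_of_not_mem hred hκ hγ hsp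
  obtain ⟨a, κ', hκ'a, -, hκ'c⟩ :=
    LevelE.exists_towerShift_iterate_eq_and_towerConst_ne_zero W p κ hirr ht
  -- Steps 3–4: the bad set `S₀` of the Euler system
  obtain ⟨S₀, hS₀, hG34⟩ :=
    hG34 W p κ γ I hp2 hirr hκ hγ hPT s hES
  -- the Selmer side: `ε`, `S₁ ⊇ S₀`
  obtain ⟨ε, S₁, hS₁, hS₀₁, hG1⟩ :=
    hG1 W p κ γ hp2 hirr hκ hγ hEP hPT S₀ hS₀
  -- a Weil pairing on `E[p]` and `μ_p ≃ ℤ/p`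
  obtain ⟨eW, hμ, hadd₁, hadd₂, halt, hnondeg, hgal⟩ :=
    W.exists_weilPairing_holds p hp.two_le (Nat.cast_ne_zero.mpr hp.ne_zero)
  -- suppose the conclusion fails: classes of arbitrarily large `T`-order
  by_contra hcon
  push Not at hcon
  -- the level `e = e' + 1 = p^n ≥ a + ε + 3`
  set n : ℕ := a + ε + 2 with hn
  have hlt : a + ε + 2 < p ^ n := Nat.lt_pow_self hp.one_lt
  obtain ⟨e', he⟩ : ∃ e' : ℕ, e' + 1 = p ^ n := ⟨p ^ n - 1, by omega⟩
  have he1 : 1 < e' + 1 := by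
    have : p ≤ p ^ n := Nat.le_self_pow (by omega) p
    have := hp.two_le
    omega
  -- the bad class `y` with `T^{2e−1} y ≠ 0` and the dual class `Ψ` at level `2e`
  obtain ⟨y, hy, hyT⟩ := hcon (2 * e' + 1)
  obtain ⟨Ψ, hΨT, hΨur, hΨε⟩ := hG1 (2 * e' + 1) y hy hyT
  obtain ⟨Ψc, hΨc⟩ := oneCocycleClass_surjective _ Ψ
  subst hΨc
  -- a cocycle `Φ` of `κ'_{2e}`
  obtain ⟨Φ, hΦ⟩ := oneCocycleClass_surjective _ (κ'.1 (2 * e' + 1 + 1))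
  -- truncations to level `e = e' + 1`
  have hle : e' + 1 ≤ 2 * e' + 1 + 1 := by omega
  set φ : contOneCocycles (W.modPTwist p κ (e' + 1)).toTopRep :=
    κ.pushCocycle (W.torsionGaloisModule (p : ℤ))
      (fun P : WeierstrassCurve.geomTorsion W (p : ℤ) => AddSubgroup.torsionBy.nsmul P) (2 * e' + 1 + 1)
      (κ.twistModPTruncate (W.torsionGaloisModule (p : ℤ)) _ (2 * e' + 1 + 1) hle) Φ with hφdef
  set ψ : contOneCocycles (W.modPTwist p κ.invTwist (e' + 1)).toTopRep :=
    κ.invTwist.pushCocycle (W.torsionGaloisModule (p : ℤ))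
      (fun P : WeierstrassCurve.geomTorsion W (p : ℤ) => AddSubgroup.torsionBy.nsmul P) (2 * e' + 1 + 1)
      (κ.invTwist.twistModPTruncate (W.torsionGaloisModule (p : ℤ)) _ (2 * e' + 1 + 1) hle) Ψc
    with hψdef
  have hφ : oneCocycleClass (W.modPTwist p κ (e' + 1)).toTopRep φ = κ'.1 (e' + 1) := by
    have h1 := (κ.mem_twistTower_iff (W.torsionGaloisModule (p : ℤ)) _ κ'.1).1 κ'.2 _ _ hle
    rw [← hΦ] at h1
    exact (ZpExtension.map_oneCocycleClass_twist κ (W.torsionGaloisModule (p : ℤ)) _ (2 * e' + 1 + 1)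
      (κ.twistModPTruncate (W.torsionGaloisModule (p : ℤ)) _ (2 * e' + 1 + 1) hle) Φ).symm.trans h1
  have hψT : (κ.invTwist.shiftH1 (W.torsionGaloisModule (p : ℤ))
      (fun P : WeierstrassCurve.geomTorsion W (p : ℤ) => AddSubgroup.torsionBy.nsmul P) (e' + 1))^[e']
        (oneCocycleClass (W.modPTwist p κ.invTwist (e' + 1)).toTopRep ψ) ≠ 0 :=
    shiftH1_iterate_truncate_ne_zero κ.invTwist (W.torsionGaloisModule (p : ℤ)) _ e' Ψc hΨT hle
  -- STEP 1 + LEMMA 4: a joint value `z` of `(φ, ψ)` whose two lowest pairing coefficients do not both vanish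
  haveI : NeZero p := ⟨hp.ne_zero⟩
  obtain ⟨z, hzMj, hz01⟩ := exists_jointValue_weil_ne_zero_of_imageFacts W p κ hp2 hirr hSC hIF
    κ' hκ'c he1 φ hφ ψ hψT eW hμ hadd₁ hadd₂ hnondeg
  -- STEP 2 (x9 g43): an `E`-split prime `q ∉ S₁` of depth `n` with a Frobenius realising `z`
  obtain ⟨N, -, -, -, -, -, -, q, hq, -, 𝔓, h𝔓, Fr, hFr, -, hφFr, hψFr, hFr1, hFrn, hFrn1⟩ :=
    exists_isArithFrobAt_mem_inf_ker_apply_eq_and_depth_of_imageFacts W p κ hSC hIF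
      (J := e' + 1) (J' := e' + 1) (n := n) (by omega) he.le he.le φ ψ hzMj S₁ hS₁
  -- STEPS 3–4 (stub): the Kolyvagin class and reciprocity at `q`
  obtain ⟨U, hU0, hrec⟩ := hG34 a κ' hκ'a n e' he Φ hΦ ε S₁ _ Ψc hS₀₁ rfl hΨur hΨε eW hμ hadd₁ hadd₂
    halt hnondeg hgal q hq 𝔓 h𝔓 Fr hFr hFr1 hFrn hFrn1
  -- the count: `C_0 = C_1 = 0` for the level-`2e` pair `(Φ(Fr), Ψc(Fr))`
  have hpC : ∀ c : DiscreteGaloisModule.MuCarrier ℚ p, (p : ℤ) • c = 0 :=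
    natCast_zsmul_muCarrier_eq_zero ℚ p
  obtain ⟨hC0, hC1⟩ := convCoeff_zero_one_eq_zero_of_reciprocity (weilPairingHom W p eW hμ hadd₁ hadd₂) hp hpC
    (m := e' + 1 + a) (ε := ε) (by omega) U hU0 (Φ.1 Fr) (Ψc.1 Fr) hrec
  -- the two lowest coefficients of the level-`2e` pair are those of `z` (truncation is definitional)
  have hk10 : Φ.1 Fr ⟨0, by omega⟩ = z.1 ⟨0, by omega⟩ := by rw [← hφFr]; rfl
  have hk11 : Φ.1 Fr ⟨1, by omega⟩ = z.1 ⟨1, he1⟩ := by rw [← hφFr]; rfl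
  have hcy0 : Ψc.1 Fr ⟨0, by omega⟩ = z.2 ⟨0, by omega⟩ := by rw [← hψFr]; rfl
  have hcy1 : Ψc.1 Fr ⟨1, by omega⟩ = z.2 ⟨1, he1⟩ := by rw [← hψFr]; rfl
  rw [convCoeff_zero_eq _ (by omega), hk10, hcy0] at hC0
  rw [convCoeff_one_eq _ (by omega), hk10, hcy1, hk11, hcy0] at hC1
  -- contradiction with the valuation `≤ 1` of `z`
  rcases hz01 with h0 | h1
  · exact h0 hC0
  · exact h1 hC1

/-- **The core under image facts HOLDS, reduction-free, at every odd prime**: for every globally minimal elliptic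
`W/ℚ`, every odd `p`, `E[p]` irreducible, (SC) and (IF), every cyclotomic `(κ, γ)` and pin `I`: a genuine Λ-adic
Euler-system class `s ∉ p𝐇¹` yields `J` with `(conj_γ − 1)^J` killing every `E[p]`-class lifting into
`Sel₀(ℚ_∞, E[p^∞])`.  The five inputs are the tree theorems of `coreOdd_anyReduction_holds` with the two K6 stubs
replaced by their binder-free forms `SelmerDual.stub_selmerDualIrr_holds`, `TameClass.stub_stepsTwoFourIrr_holds`
(parts E/F). [cite: Kato2004Asterisque, §13.8 (pp. 228–229) with Lemma 8.5 (2) (p. 183), Thm. 12.6 (p. 222)]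
[cite: MilneADT2006, Ch. I, Thm. 4.10(b)] -/
theorem coreIrr_anyReduction_holds :
    ∀ (W : WeierstrassCurve ℚ) [W.IsElliptic] [W.IsGloballyMinimal] (p : ℕ) [Fact p.Prime]
      [ContinuousSMul ℤ_[p] (W.tateModule p)] [Module.Free ℤ_[p] (W.tateModule p)]
      [Module.Finite ℤ_[p] (W.tateModule p)]
      (κ : ZpExtension ℚ p) (γ : absoluteGaloisGroup ℚ) (I : IwasawaH1Data W p κ γ),
      p ≠ 2 → W.HasIrreducibleModPGaloisRep p →
      (∃ (z : absoluteGaloisGroup ℚ) (a : ZMod p), a ≠ 1 ∧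
        ∀ P : WeierstrassCurve.geomTorsion W (p : ℤ), z • P = a.val • P) →
      (∀ N : Subgroup (absoluteGaloisGroup ℚ), N.Normal →
        (WeierstrassCurve.galoisRepTorsion W (p : ℕ)).ker ≤ N → N.index ≠ p) →
      κ.IsCyclotomic → κ.IsTopGenerator γ →
      (∃ s : I.H, IsEulerSystemClass W p κ γ I s ∧
        s ∉ IwasawaAlgebra.augIdealP p • (⊤ : Submodule (IwasawaAlgebra p) I.H)) →
      ∃ J : ℕ, ∀ y : Literature.NumberTheory.EllipticCurves.subgroupH1 κ.kerSubgroup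
          (WeierstrassCurve.geomTorsion W (p : ℤ)),
        W.torsionToPrimaryH1Sub p κ.kerSubgroup y ∈ W.fineSelmerInfty κ →
          (⇑(Literature.NumberTheory.EllipticCurves.conjH1 κ.kerSubgroup
              (WeierstrassCurve.geomTorsion W (p : ℤ)) γ -
            AddMonoidHom.id (Literature.NumberTheory.EllipticCurves.subgroupH1 κ.kerSubgroup
              (WeierstrassCurve.geomTorsion W (p : ℤ)))))^[J] y = 0 :=
  coreIrr_anyReduction_of_selmerDual_of_stepsTwoFour
    (mem_pSmul_of_red_eq_zero_of_integral_of_smul_mem fun W _ p _ _ κ hκ z hz hpz n =>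
      UniversalNorms.mem_integralH1_of_layerCores_eq_of_smul_mem W p κ hκ z hz hpz n)
    (poitouTate_sum_localTatePairing_eq_zero_holds ℚ)
    (Summit.BirchSwinnertonDyer.Rank1Residual.GaloisImage.EP.forall_localEulerPoincareCharacteristic_adicCompletion ℚ)
    SelmerDual.stub_selmerDualIrr_holds TameClass.stub_stepsTwoFourIrr_holds

/-- **The core at `p = 3` for EVERY `E/ℚ` with `E[3]` IRREDUCIBLE — `ρ̄_{E,3}` onto or not (9-deficient rows
included)**: `coreIrr_anyReduction_holds` with (SC) from `imageFactSC_three_of_irr` (stepL/b2b's `−1 ∈ ρ̄₃(Γ_ℚ)`)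
and (IF) from `IrrThreeDisjoint.forall_normal_index_ne_three_of_irr` (k9-c4 g14).
[cite: Kato2004Asterisque, §13.8 (pp. 228–229)] [cite: Serre1972, §2.4 Prop. 15, §2.5–2.6] -/
theorem coreThree_anyReduction_of_irr :
    ∀ (W : WeierstrassCurve ℚ) [W.IsElliptic] [W.IsGloballyMinimal] [Fact (Nat.Prime 3)]
      [ContinuousSMul ℤ_[3] (W.tateModule 3)] [Module.Free ℤ_[3] (W.tateModule 3)]
      [Module.Finite ℤ_[3] (W.tateModule 3)]
      (κ : ZpExtension ℚ 3) (γ : absoluteGaloisGroup ℚ) (I : IwasawaH1Data W 3 κ γ),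
      W.HasIrreducibleModPGaloisRep 3 →
      κ.IsCyclotomic → κ.IsTopGenerator γ →
      (∃ s : I.H, IsEulerSystemClass W 3 κ γ I s ∧
        s ∉ IwasawaAlgebra.augIdealP 3 • (⊤ : Submodule (IwasawaAlgebra 3) I.H)) →
      ∃ J : ℕ, ∀ y : Literature.NumberTheory.EllipticCurves.subgroupH1 κ.kerSubgroup
          (WeierstrassCurve.geomTorsion W ((3 : ℕ) : ℤ)),
        W.torsionToPrimaryH1Sub 3 κ.kerSubgroup y ∈ W.fineSelmerInfty κ →
          (⇑(Literature.NumberTheory.EllipticCurves.conjH1 κ.kerSubgroup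
              (WeierstrassCurve.geomTorsion W ((3 : ℕ) : ℤ)) γ -
            AddMonoidHom.id (Literature.NumberTheory.EllipticCurves.subgroupH1 κ.kerSubgroup
              (WeierstrassCurve.geomTorsion W ((3 : ℕ) : ℤ)))))^[J] y = 0 := by
  intro W _ _ _ _ _ _ κ γ I hirr hκ hγ hs
  exact coreIrr_anyReduction_holds W 3 κ γ I (by decide) hirr (imageFactSC_three_of_irr W hirr)
    (Theorems.IrrThreeDisjoint.forall_normal_index_ne_three_of_irr W hirr) hκ hγ hs

end Summit.BirchSwinnertonDyer.BirchSwinnertonDyer.Rank1Residual.CoreAssembly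

end
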